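import Literature.AlgebraicGeometry.Motives.WeilFormIsotropicBlockVectorsAll
import HarnessLib

/-!
# Route HeckePrymWeil · crux `WeilSixfoldsSqrtMinus7` (stmt-HodgeConjecture-1260) · line
# `real-quadratic-base-change` · stub 2a `stub_splittingArithmetic` — the rational core

Pure `ℚ`-linear algebra behind the SPLITTING of the base change `A ⊗ O_F` (`F = ℚ(√t)`) of a
`ℚ(√-7)`-Weil sixfold (van Geemen, LNM 1594, Lemma 5.2 (3) and 5.4; Markman, arXiv:2509.23079,
Lemma 8.3.4 (2) = Deligne–Milne: the relative hermitian form `H_A ⊗_K L` is split as soon as its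
discriminant is a relative norm). Data: a `ℚ`-vector space `V` with a Weil operator `J` (`J² = -d`)
and an alternating form `E` of Weil type (`E(Jx, y) = -E(x, Jy)`); a totally `E`-isotropic
`J`-stable subspace `L`; two vectors `p`, `q`, `H`-orthogonal to `L` and to each other, anisotropic
(`S(p) = E(p, Jp) ≠ 0`, `S(q) ≠ 0`); and scalars `τ`, `r ≠ 0` with the AIMING RELATION
`τ r² S(p) + S(q) = 0`. Output (`exists_splitSubspace`): a subspace `U ⊆ V × V` of dimension
`2 dim L + 4`, stable under `J ⊕ J` and under `Ψ_τ : (x, y) ↦ (y, τ x)` (multiplication by `√τ` on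
`V ⊗ F`, coordinates `(x, y) ↔ y + √τ x`), and totally isotropic for `τE ⊕ E`:
`U = (L × L) ⊕ ⟨w₁, Jw₁, w₂, Jw₂⟩` with `w₁ = (r p, q)`, `w₂ = Ψ_τ w₁ = (q, τ r p)`.
Consumed by `stub_splittingArithmetic` (file `…SplittingArithmetic.lean`). Everything is proved;
theorems only.
-/

noncomputable section

-- single-problem summit (Problem = Summit): the mandated namespace repeats `HodgeConjecture`.
set_option linter.dupNamespace false

open Module

namespace Summit.HodgeConjecture.HodgeConjecture.Theorems.WeilSixfoldsSqrtMinus7.RealQuadraticBaseChange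

section Core

variable {V : Type*} [AddCommGroup V] [Module ℚ V]

/-- A bilinear form vanishing on all pairs of a set vanishes on all pairs of its span. [folklore] -/
theorem bilin_eq_zero_of_mem_span {W : Type*} [AddCommGroup W] [Module ℚ W]
    (B : W →ₗ[ℚ] W →ₗ[ℚ] ℚ) (s : Set W) (hs : ∀ a ∈ s, ∀ b ∈ s, B a b = 0)
    {x y : W} (hx : x ∈ Submodule.span ℚ s) (hy : y ∈ Submodule.span ℚ s) : B x y = 0 := by
  have h1 : ∀ a ∈ s, B a y = 0 := by
    intro a ha
    induction hy using Submodule.span_induction with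
    | mem b hb => exact hs a ha b hb
    | zero => simp
    | add u v _ _ hu hv => rw [map_add, hu, hv, add_zero]
    | smul c u _ hu => rw [map_smul, hu, smul_zero]
  induction hx using Submodule.span_induction with
  | mem a ha => exact h1 a ha
  | zero => simp
  | add u v _ _ hu hv => rw [map_add, LinearMap.add_apply, hu, hv, add_zero]
  | smul c u _ hu => rw [map_smul, LinearMap.smul_apply, hu, smul_zero]

variable (J : V →ₗ[ℚ] V) {d : ℚ} (E : LinearMap.BilinForm ℚ V)

/-- **Directness `L ⊕ ℚp ⊕ ℚJp ⊕ ℚq ⊕ ℚJq`**: with `L` killed by `E(p, ·)`, `E(p, J·)`, `E(q, ·)`,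
`E(q, J·)`, `p ⊥_H q`, and `S(p), S(q) ≠ 0`, a vanishing combination `a p + b Jp + c q + e Jq + x = 0`
(`x ∈ L`) has `a = b = c = e = 0` — pair it with the four functionals. [folklore] -/
theorem coeffs_eq_zero_of_combination_add_mem_eq_zero (hJ : ∀ v, J (J v) = -(d • v))
    (hE : ∀ x y, E x y = -E y x) (hJE : ∀ x y, E (J x) y = -E x (J y))
    (L : Submodule ℚ V) {p q : V}
    (hpL : ∀ x ∈ L, E p x = 0) (hpJL : ∀ x ∈ L, E p (J x) = 0)
    (hqL : ∀ x ∈ L, E q x = 0) (hqJL : ∀ x ∈ L, E q (J x) = 0)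
    (hpq : E p q = 0) (hpJq : E p (J q) = 0) (hp0 : E p (J p) ≠ 0) (hq0 : E q (J q) ≠ 0)
    {a b c e : ℚ} {x : V} (hx : x ∈ L) (h : a • p + b • J p + c • q + e • J q + x = 0) :
    a = 0 ∧ b = 0 ∧ c = 0 ∧ e = 0 := by
  have hpp : E p p = 0 := by have := hE p p; linarith
  have hqq : E q q = 0 := by have := hE q q; linarith
  have hqp : E q p = 0 := by rw [hE, hpq, neg_zero]
  have hqJp : E q (J p) = 0 := by rw [hE, hJE, hpJq, neg_neg]
  -- pair with `E(p, J·)`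
  have f1 := congrArg (fun v => E p (J v)) h
  simp only [map_add, map_smul, hJ, map_neg, smul_eq_mul, map_zero, hpp, hpJq, hpq,
    hpJL x hx, mul_zero, neg_zero, add_zero] at f1
  -- pair with `E(p, ·)`
  have f2 := congrArg (fun v => E p v) h
  simp only [map_add, map_smul, smul_eq_mul, map_zero, hpp, hpJq, hpq, hpL x hx, mul_zero,
    add_zero, zero_add] at f2
  -- pair with `E(q, J·)`
  have f3 := congrArg (fun v => E q (J v)) h
  simp only [map_add, map_smul, hJ, map_neg, smul_eq_mul, map_zero, hqq, hqp, hqJp,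
    hqJL x hx, mul_zero, neg_zero, add_zero, zero_add] at f3
  -- pair with `E(q, ·)`
  have f4 := congrArg (fun v => E q v) h
  simp only [map_add, map_smul, smul_eq_mul, map_zero, hqq, hqp, hqJp, hqL x hx, mul_zero,
    add_zero, zero_add] at f4
  refine ⟨?_, ?_, ?_, ?_⟩
  · exact (mul_eq_zero.1 f1).resolve_right hp0
  · exact (mul_eq_zero.1 f2).resolve_right hp0
  · exact (mul_eq_zero.1 f3).resolve_right hq0
  · exact (mul_eq_zero.1 f4).resolve_right hq0

/-- **The split subspace of the base change** (van Geemen 5.2 (3)/5.4 for the relative form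
`H ⊗_K L`, made explicit). In the setting of the module docstring there is `U ⊆ V × V` with
`dim U = 2 dim L + 4`, stable under `J ⊕ J` and `(x, y) ↦ (y, τ x)`, and totally isotropic for
`(u, u') ↦ τ E(u₁, u'₁) + E(u₂, u'₂)`: `U = (L × L) ⊕ ⟨(rp, q), (rJp, Jq), (q, τrp), (Jq, τrJp)⟩`; the
one non-formal isotropy `Q(w₁, Jw₁) = τ r² S(p) + S(q)` is the aiming relation.
[cite: vanGeemen1994HodgeAV, Lemma 5.2 (3) and 5.4 (5.4.1)] -/
theorem exists_splitSubspace_aux [FiniteDimensional ℚ V] (hJ : ∀ v, J (J v) = -(d • v))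
    (hE : ∀ x y, E x y = -E y x) (hJE : ∀ x y, E (J x) y = -E x (J y))
    (L : Submodule ℚ V) (hLJ : ∀ x ∈ L, J x ∈ L) (hLiso : ∀ x ∈ L, ∀ y ∈ L, E x y = 0) {p q : V}
    (hpL : ∀ x ∈ L, E p x = 0) (hpJL : ∀ x ∈ L, E p (J x) = 0)
    (hqL : ∀ x ∈ L, E q x = 0) (hqJL : ∀ x ∈ L, E q (J x) = 0)
    (hpq : E p q = 0) (hpJq : E p (J q) = 0) (hp0 : E p (J p) ≠ 0) (hq0 : E q (J q) ≠ 0)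
    {τ r : ℚ} (hr : r ≠ 0) (hstar : τ * r ^ 2 * E p (J p) + E q (J q) = 0) :
    ∃ U : Submodule ℚ (V × V), finrank ℚ U = 2 * finrank ℚ L + 4 ∧
      (∀ u ∈ U, (J u.1, J u.2) ∈ U) ∧ (∀ u ∈ U, (u.2, τ • u.1) ∈ U) ∧
      ∀ u ∈ U, ∀ u' ∈ U, τ * E u.1 u'.1 + E u.2 u'.2 = 0 := by
  classical
  -- scalar bookkeeping
  have hpp : E p p = 0 := by have := hE p p; linarith
  have hqq : E q q = 0 := by have := hE q q; linarith
  have hJpJp : E (J p) (J p) = 0 := by have := hE (J p) (J p); linarith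
  have hJqJq : E (J q) (J q) = 0 := by have := hE (J q) (J q); linarith
  have hqp : E q p = 0 := by rw [hE, hpq, neg_zero]
  have hqJp : E q (J p) = 0 := by rw [hE, hJE, hpJq, neg_neg]
  have hJpq : E (J p) q = 0 := by rw [hJE, hpJq, neg_zero]
  have hJqp : E (J q) p = 0 := by rw [hJE, hqJp, neg_zero]
  have hJpJq : E (J p) (J q) = 0 := by
    rw [hJE, hJ, map_neg, map_smul, hpq, smul_zero, neg_zero, neg_zero]
  have hJqJp : E (J q) (J p) = 0 := by
    rw [hJE, hJ, map_neg, map_smul, hqp, smul_zero, neg_zero, neg_zero]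
  have hxp : ∀ x ∈ L, E x p = 0 := fun x hx => by rw [hE, hpL x hx, neg_zero]
  have hxq : ∀ x ∈ L, E x q = 0 := fun x hx => by rw [hE, hqL x hx, neg_zero]
  have hxJp : ∀ x ∈ L, E x (J p) = 0 := fun x hx => by rw [hE, hJE, hpJL x hx, neg_neg]
  have hxJq : ∀ x ∈ L, E x (J q) = 0 := fun x hx => by rw [hE, hJE, hqJL x hx, neg_neg]
  -- the four extra generators
  set w₁ : V × V := (r • p, q) with hw₁
  set w₂ : V × V := (q, (τ * r) • p) with hw₂
  set v₁ : V × V := (r • J p, J q) with hv₁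
  set v₂ : V × V := (J q, (τ * r) • J p) with hv₂
  set g : Fin 4 → V × V := ![w₁, v₁, w₂, v₂] with hg
  have hg0 : g 0 = w₁ := rfl
  have hg1 : g 1 = v₁ := rfl
  have hg2 : g 2 = w₂ := rfl
  have hg3 : g 3 = v₂ := rfl
  -- a property of the four generators is a property of every `g i`
  have hforall : ∀ P : V × V → Prop, P w₁ → P v₁ → P w₂ → P v₂ → ∀ i, P (g i) := by
    intro P h0 h1 h2 h3 i
    fin_cases i
    exacts [h0, h1, h2, h3]
  set S₁ : Submodule ℚ (V × V) := L.prod L with hS₁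
  set S₂ : Submodule ℚ (V × V) := Submodule.span ℚ (Set.range g) with hS₂
  -- directness of the four first components against `L`
  have hindep : ∀ (c : Fin 4 → ℚ) (x : V), x ∈ L →
      (c 0 * r) • p + (c 1 * r) • J p + c 2 • q + c 3 • J q + x = 0 → c = 0 := by
    intro c x hx h
    obtain ⟨h0, h1, h2, h3⟩ := coeffs_eq_zero_of_combination_add_mem_eq_zero J E hJ hE hJE L hpL
      hpJL hqL hqJL hpq hpJq hp0 hq0 hx h
    funext i
    fin_cases i
    · exact (mul_eq_zero.1 h0).resolve_right hr
    · exact (mul_eq_zero.1 h1).resolve_right hr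
    · exact h2
    · exact h3
  have hsum : ∀ c : Fin 4 → ℚ, (∑ i, c i • g i).1 =
      (c 0 * r) • p + (c 1 * r) • J p + c 2 • q + c 3 • J q := by
    intro c
    simp only [Fin.sum_univ_four, hg0, hg1, hg2, hg3, hw₁, hv₁, hw₂, hv₂, Prod.fst_add,
      Prod.smul_fst, smul_smul]
  -- `g` is linearly independent
  have hLI : LinearIndependent ℚ g := by
    rw [Fintype.linearIndependent_iff]
    intro c hc i
    have h1 : (∑ i, c i • g i).1 = 0 := by rw [hc]; rfl
    rw [hsum] at h1
    have := hindep c 0 L.zero_mem (by rw [h1, add_zero])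
    exact congrFun this i
  have hfinS₂ : finrank ℚ S₂ = 4 := by
    rw [hS₂, finrank_span_eq_card hLI, Fintype.card_fin]
  have hfinS₁ : finrank ℚ S₁ = finrank ℚ L + finrank ℚ L := by
    rw [hS₁]
    exact Literature.AlgebraicGeometry.Motives.finrank_submoduleProd L L
  -- `S₁ ⊓ S₂ = ⊥`
  have hinf : S₁ ⊓ S₂ = ⊥ := by
    rw [eq_bot_iff]
    intro u hu
    obtain ⟨hu₁, hu₂⟩ := Submodule.mem_inf.1 hu
    obtain ⟨c, rfl⟩ := (Submodule.mem_span_range_iff_exists_fun ℚ).1 hu₂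
    have hx : -(∑ i, c i • g i).1 ∈ L := L.neg_mem (Submodule.mem_prod.1 hu₁).1
    have hc : c = 0 := hindep c _ hx (by rw [← hsum, add_neg_cancel])
    simp [hc]
  -- the stabilising maps and the form
  set JJ : V × V →ₗ[ℚ] V × V := J.prodMap J with hJJ
  set Ψ : V × V →ₗ[ℚ] V × V := (LinearMap.snd ℚ V V).prod (τ • LinearMap.fst ℚ V V) with hΨ
  have hJJ_apply : ∀ u : V × V, JJ u = (J u.1, J u.2) := fun u => rfl
  have hΨ_apply : ∀ u : V × V, Ψ u = (u.2, τ • u.1) := fun u => rfl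
  set Q : (V × V) →ₗ[ℚ] (V × V) →ₗ[ℚ] ℚ :=
    τ • E.compl₁₂ (LinearMap.fst ℚ V V) (LinearMap.fst ℚ V V) +
      E.compl₁₂ (LinearMap.snd ℚ V V) (LinearMap.snd ℚ V V) with hQ
  have hQ_apply : ∀ u u' : V × V, Q u u' = τ * E u.1 u'.1 + E u.2 u'.2 := fun u u' => rfl
  have hQalt : ∀ u u' : V × V, Q u u' = -Q u' u := fun u u' => by
    rw [hQ_apply, hQ_apply, hE u'.1, hE u'.2]; ring
  -- images of the generators
  have hJw₁ : JJ w₁ = v₁ := by rw [hJJ_apply, hw₁, hv₁, map_smul]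
  have hJw₂ : JJ w₂ = v₂ := by rw [hJJ_apply, hw₂, hv₂, map_smul]
  have hJv₁ : JJ v₁ = (-d) • w₁ := by
    rw [hJJ_apply, hv₁, hw₁]
    ext <;> simp [hJ, smul_smul, mul_comm]
  have hJv₂ : JJ v₂ = (-d) • w₂ := by
    rw [hJJ_apply, hv₂, hw₂]
    ext <;> simp [hJ, smul_smul, mul_comm]
  have hΨw₁ : Ψ w₁ = w₂ := by
    rw [hΨ_apply, hw₁, hw₂]
    ext <;> simp [smul_smul]
  have hΨv₁ : Ψ v₁ = v₂ := by
    rw [hΨ_apply, hv₁, hv₂]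
    ext <;> simp [smul_smul]
  have hΨw₂ : Ψ w₂ = τ • w₁ := by
    rw [hΨ_apply, hw₂, hw₁]
    ext <;> simp [smul_smul]
  have hΨv₂ : Ψ v₂ = τ • v₁ := by
    rw [hΨ_apply, hv₂, hv₁]
    ext <;> simp [smul_smul]
  have hmem : ∀ i, g i ∈ S₂ := fun i => Submodule.subset_span ⟨i, rfl⟩
  have hmw₁ : w₁ ∈ S₂ := hmem 0
  have hmv₁ : v₁ ∈ S₂ := hmem 1
  have hmw₂ : w₂ ∈ S₂ := hmem 2
  have hmv₂ : v₂ ∈ S₂ := hmem 3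
  refine ⟨S₁ ⊔ S₂, ?_, ?_, ?_, ?_⟩
  · -- dimension
    haveI : FiniteDimensional ℚ S₁ := FiniteDimensional.finiteDimensional_submodule _
    haveI : FiniteDimensional ℚ S₂ := FiniteDimensional.finiteDimensional_submodule _
    have h := Submodule.finrank_sup_add_finrank_inf_eq S₁ S₂
    rw [hinf, finrank_bot, add_zero, hfinS₂, hfinS₁] at h
    omega
  · -- `J ⊕ J`-stability
    have hle : S₁ ⊔ S₂ ≤ (S₁ ⊔ S₂).comap JJ := by
      refine sup_le ?_ (Submodule.span_le.2 ?_)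
      · intro u hu
        obtain ⟨h1, h2⟩ := Submodule.mem_prod.1 hu
        exact Submodule.mem_sup_left (Submodule.mem_prod.2 ⟨hLJ _ h1, hLJ _ h2⟩)
      · rintro _ ⟨i, rfl⟩
        change JJ (g i) ∈ S₁ ⊔ S₂
        refine Submodule.mem_sup_right (hforall (fun u => JJ u ∈ S₂) ?_ ?_ ?_ ?_ i)
        · rw [hJw₁]; exact hmv₁
        · rw [hJv₁]; exact S₂.smul_mem _ hmw₁
        · rw [hJw₂]; exact hmv₂
        · rw [hJv₂]; exact S₂.smul_mem _ hmw₂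
    intro u hu
    exact hle hu
  · -- `Ψ`-stability
    have hle : S₁ ⊔ S₂ ≤ (S₁ ⊔ S₂).comap Ψ := by
      refine sup_le ?_ (Submodule.span_le.2 ?_)
      · intro u hu
        obtain ⟨h1, h2⟩ := Submodule.mem_prod.1 hu
        exact Submodule.mem_sup_left (Submodule.mem_prod.2 ⟨h2, L.smul_mem _ h1⟩)
      · rintro _ ⟨i, rfl⟩
        change Ψ (g i) ∈ S₁ ⊔ S₂
        refine Submodule.mem_sup_right (hforall (fun u => Ψ u ∈ S₂) ?_ ?_ ?_ ?_ i)
        · rw [hΨw₁]; exact hmw₂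
        · rw [hΨv₁]; exact hmv₂
        · rw [hΨw₂]; exact S₂.smul_mem _ hmw₁
        · rw [hΨv₂]; exact S₂.smul_mem _ hmv₁
    intro u hu
    exact hle hu
  · -- total isotropy: check `Q` on pairs of generators of `S₁ ⊔ S₂ = span (S₁ ∪ range g)`
    have hgen : S₁ ⊔ S₂ = Submodule.span ℚ ((S₁ : Set (V × V)) ∪ Set.range g) := by
      rw [Submodule.span_union, Submodule.span_eq]
    have hQ11 : ∀ a ∈ S₁, ∀ b ∈ S₁, Q a b = 0 := by
      intro a ha b hb
      obtain ⟨ha1, ha2⟩ := Submodule.mem_prod.1 ha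
      obtain ⟨hb1, hb2⟩ := Submodule.mem_prod.1 hb
      rw [hQ_apply, hLiso _ ha1 _ hb1, hLiso _ ha2 _ hb2, mul_zero, add_zero]
    have hQ1g : ∀ a ∈ S₁, ∀ i, Q a (g i) = 0 := by
      intro a ha
      obtain ⟨ha1, ha2⟩ := Submodule.mem_prod.1 ha
      refine hforall (fun u => Q a u = 0) ?_ ?_ ?_ ?_
      · rw [hQ_apply, hw₁, map_smul, hxp _ ha1, hxq _ ha2, smul_zero, mul_zero, add_zero]
      · rw [hQ_apply, hv₁, map_smul, hxJp _ ha1, hxJq _ ha2, smul_zero, mul_zero, add_zero]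
      · rw [hQ_apply, hw₂, map_smul, hxq _ ha1, hxp _ ha2, smul_zero, mul_zero, add_zero]
      · rw [hQ_apply, hv₂, map_smul, hxJq _ ha1, hxJp _ ha2, smul_zero, mul_zero, add_zero]
    -- the sixteen pairs: diagonal by alternation, six computed, six by transposition
    have d₀ : ∀ u : V × V, Q u u = 0 := fun u => by have := hQalt u u; linarith
    have e01 : Q w₁ v₁ = 0 := by
      simp only [hQ_apply, hw₁, hv₁, map_smul, LinearMap.smul_apply, smul_eq_mul]
      linear_combination hstar
    have e02 : Q w₁ w₂ = 0 := by
      simp only [hQ_apply, hw₁, hw₂, map_smul, LinearMap.smul_apply, smul_eq_mul, hpq, hqp,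
        mul_zero, add_zero]
    have e03 : Q w₁ v₂ = 0 := by
      simp only [hQ_apply, hw₁, hv₂, map_smul, LinearMap.smul_apply, smul_eq_mul, hpJq, hqJp,
        mul_zero, add_zero]
    have e12 : Q v₁ w₂ = 0 := by
      simp only [hQ_apply, hv₁, hw₂, map_smul, LinearMap.smul_apply, smul_eq_mul, hJpq, hJqp,
        mul_zero, add_zero]
    have e13 : Q v₁ v₂ = 0 := by
      simp only [hQ_apply, hv₁, hv₂, map_smul, LinearMap.smul_apply, smul_eq_mul, hJpJq, hJqJp,
        mul_zero, add_zero]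
    have e23 : Q w₂ v₂ = 0 := by
      simp only [hQ_apply, hw₂, hv₂, map_smul, LinearMap.smul_apply, smul_eq_mul]
      linear_combination τ * hstar
    have e10 : Q v₁ w₁ = 0 := by rw [hQalt, e01, neg_zero]
    have e20 : Q w₂ w₁ = 0 := by rw [hQalt, e02, neg_zero]
    have e30 : Q v₂ w₁ = 0 := by rw [hQalt, e03, neg_zero]
    have e21 : Q w₂ v₁ = 0 := by rw [hQalt, e12, neg_zero]
    have e31 : Q v₂ v₁ = 0 := by rw [hQalt, e13, neg_zero]
    have e32 : Q v₂ w₂ = 0 := by rw [hQalt, e23, neg_zero]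
    have hQgg : ∀ i j, Q (g i) (g j) = 0 := fun i =>
      hforall (fun u => ∀ j, Q u (g j) = 0)
        (hforall (fun u => Q w₁ u = 0) (d₀ w₁) e01 e02 e03)
        (hforall (fun u => Q v₁ u = 0) e10 (d₀ v₁) e12 e13)
        (hforall (fun u => Q w₂ u = 0) e20 e21 (d₀ w₂) e23)
        (hforall (fun u => Q v₂ u = 0) e30 e31 e32 (d₀ v₂)) i
    have hs : ∀ a ∈ (S₁ : Set (V × V)) ∪ Set.range g, ∀ b ∈ (S₁ : Set (V × V)) ∪ Set.range g,
        Q a b = 0 := by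
      rintro a (ha | ⟨i, rfl⟩) b (hb | ⟨j, rfl⟩)
      · exact hQ11 a ha b hb
      · exact hQ1g a ha j
      · rw [hQalt, hQ1g b hb i, neg_zero]
      · exact hQgg i j
    intro u hu u' hu'
    rw [hgen] at hu hu'
    rw [← hQ_apply]
    exact bilin_eq_zero_of_mem_span Q _ hs hu hu'

/-- **The split subspace of the base change** — registered sub-goal `exists_splitSubspace` of crux
stmt-HodgeConjecture-1260 (line `real-quadratic-base-change`), the statement of
`exists_splitSubspace_aux` in closed form. [cite: vanGeemen1994HodgeAV, Lemma 5.2 (3) and 5.4 (5.4.1)] -/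
theorem exists_splitSubspace :
    ∀ {V : Type*} [AddCommGroup V] [Module ℚ V] (J : V →ₗ[ℚ] V) {d : ℚ} (E : LinearMap.BilinForm ℚ
      V) [FiniteDimensional ℚ V], (∀ v, J (J v) = -(d • v)) → (∀ x y, E x y = -E y x) → (∀ x y, E (J
      x) y = -E x (J y)) → ∀ (L : Submodule ℚ V), (∀ x ∈ L, J x ∈ L) → (∀ x ∈ L, ∀ y ∈ L, E x y = 0)
      → ∀ {p q : V}, (∀ x ∈ L, E p x = 0) → (∀ x ∈ L, E p (J x) = 0) → (∀ x ∈ L, E q x = 0) → (∀ x ∈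
      L, E q (J x) = 0) → E p q = 0 → E p (J q) = 0 → E p (J p) ≠ 0 → E q (J q) ≠ 0 → ∀ {τ r : ℚ}, r
      ≠ 0 → τ * r ^ 2 * E p (J p) + E q (J q) = 0 → ∃ U : Submodule ℚ (V × V), Module.finrank ℚ U =
      2 * Module.finrank ℚ L + 4 ∧ (∀ u ∈ U, (J u.1, J u.2) ∈ U) ∧ (∀ u ∈ U, (u.2, τ • u.1) ∈ U) ∧ ∀
      u ∈ U, ∀ u' ∈ U, τ * E u.1 u'.1 + E u.2 u'.2 = 0 := by
  intro V _ _ J d E _ hJ hE hJE L hLJ hLiso p q hpL hpJL hqL hqJL hpq hpJq hp0 hq0 τ r hr hstar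
  exact exists_splitSubspace_aux J E hJ hE hJE L hLJ hLiso hpL hpJL hqL hqJL hpq hpJq hp0 hq0 hr hstar

end Core

end Summit.HodgeConjecture.HodgeConjecture.Theorems.WeilSixfoldsSqrtMinus7.RealQuadraticBaseChange

end
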